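import Literature.Analysis.PDE.FlatSup
import Literature.Analysis.PDE.AffineWordBounds
import Literature.Analysis.PDE.FrameOpSmooth
import HarnessLib

/-!
# The flat fine parametrix: uniform coefficient and cut-off bounds for framed lattice families
# (topic `Analysis/PDE`)

Layer (I') of the programme to prove short-time existence for quasilinear strictly parabolic
systems on a closed manifold (hypothesis `hQL` of
`Literature.Geometry.Riemannian.ricciFlow_shortTime_existence_of_quasilinear`). The contraction
and pointwise-in-time estimates of `FlatStepEnergy.lean`, `FlatNeumann.lean`, `FlatSup.lean` take
as hypotheses per-patch slice bounds of the flat local residual, word bounds of the partition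
multipliers in adapted coordinates, and transport constants — all UNIFORM in the patch and in
time. This file discharges them for families whose partition functions are translates of one
profile (`LatticePartition.lean`), frames with uniform operator-norm bounds, and coefficient
fields with uniform bounds of their spatial iterated derivatives: the constants are chosen from
the radius, the profile, the frame bounds and the coefficient bounds BEFORE the patch family, so
that they do not depend on the size of its region.

* generic: `norm_iteratedFDeriv_comp_affine_le`, `norm_iteratedFDeriv_postcomp_le`,
  `norm_iteratedFDeriv_precomp_le`, `norm_iteratedFDeriv_inner_apply_le`;
* cut-offs: `cutAd_eq_comp`, the frame-word bounds of `cutAd`, `∂cutAd`, `∂∂cutAd`, `ΔcutAd`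
  (`cutAd_words_le` …);
* the slice bounds `flat_hslice` (orders `k ≤ K`), the multiplier bounds `flat_hρw`, the transport
  constants `flat_htr`, `flat_hpush`.

Everything is proved; no named fact and no `sorry` is introduced.

## References

* L. Hörmander, *The Analysis of Linear Partial Differential Operators III*, Springer 1985,
  §17.1. [Hormander1985III]
-/

noncomputable section

open Set Function Filter Topology Metric MeasureTheory InnerProductSpace
open scoped ContDiff Topology ENNReal RealInnerProductSpace Laplacian

namespace Literature.Analysis.PDE

open Literature.Analysis.FunctionSpaces Literature.Analysis.FluidPDE TopologicalSpace

variable {E' : Type*} [NormedAddCommGroup E'] [InnerProductSpace ℝ E'] [FiniteDimensional ℝ E']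
variable {F : Type*} [NormedAddCommGroup F] [NormedSpace ℝ F]


/-! ### The cut-offs in adapted coordinates: frame-word bounds -/

namespace FlatStep

variable {ι : Type*} [Fintype ι] (Q : FlatPatches E' ι) (A : ι → E' ≃L[ℝ] E')

/-- The model cut-off: the patch cut-off centred at `0`. [folklore] -/
def cut0 : ContDiffBump (0 : E') := ⟨2 * Q.r, 3 * Q.r, by linarith [Q.r_pos], by linarith [Q.r_pos]⟩

/-- The model outer cut-off. [folklore] -/
def cutP0 : ContDiffBump (0 : E') := ⟨3 * Q.r, 4 * Q.r, by linarith [Q.r_pos], by linarith [Q.r_pos]⟩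

/-- **The pulled-back cut-off is the model cut-off composed with the inverse frame**:
`cut̃_i z = cut₀ (A_i⁻¹ z)`. [folklore] -/
theorem cutAd_eq (i : ι) (z : E') : cutAd Q A i z = cut0 Q ((A i).symm z) := by
  rw [cutAd, psi, ContDiffBump.apply, ContDiffBump.apply]
  simp [FlatPatches.cut, cut0]

/-- The pulled-back outer cut-off is the model outer cut-off composed with the inverse frame.
[folklore] -/
theorem cutPAd_eq (i : ι) (z : E') : cutPAd Q A i z = cutP0 Q ((A i).symm z) := by
  rw [cutPAd, psi, ContDiffBump.apply, ContDiffBump.apply]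
  simp [FlatPatches.cutPlus, cutP0]

/-- Function form of `cutAd_eq` (affine with zero translation). [folklore] -/
theorem cutAd_eq_fun (i : ι) : cutAd Q A i = fun z ↦ cut0 Q (((A i).symm : E' →L[ℝ] E') z + 0) := by
  funext z; rw [cutAd_eq, add_zero]; rfl

/-- Function form of `cutPAd_eq`. [folklore] -/
theorem cutPAd_eq_fun (i : ι) : cutPAd Q A i = fun z ↦ cutP0 Q (((A i).symm : E' →L[ℝ] E') z + 0) := by
  funext z; rw [cutPAd_eq, add_zero]; rfl

variable {Q A}

/-- **Frame words of the pulled-back cut-off**: `‖∂_β cut̃_i(z)‖ ≤ a₂^{|β|} M_b` when `‖A_i⁻¹‖ ≤ a₂`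
and `‖Dᵐ cut₀‖ ≤ M_b` for `m = |β|`. [folklore] -/
theorem cutAd_word_le {a₂ : ℝ} (ha₂ : ∀ i, ‖((A i).symm : E' →L[ℝ] E')‖ ≤ a₂) (i : ι)
    (lst : List (Fin (Module.finrank ℝ E'))) {Mb : ℝ} (hMb : ∀ x, ‖iteratedFDeriv ℝ lst.length (cut0 Q) x‖ ≤ Mb) (z : E') :
    ‖iterDirDeriv (lst.map (stdOrthonormalBasis ℝ E')) (cutAd Q A i) z‖ ≤ a₂ ^ lst.length * Mb := by
  have ha0 : 0 ≤ a₂ := (norm_nonneg _).trans (ha₂ i)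
  rw [cutAd_eq_fun]
  refine (norm_iterDirDeriv_frame_comp_affine_le _ _ (cut0 Q).contDiff lst z).trans ?_
  exact mul_le_mul (pow_le_pow_left₀ (norm_nonneg _) (ha₂ i) _) (hMb _) (norm_nonneg _) (pow_nonneg ha0 _)

/-- The same for the outer cut-off, in iterated-derivative form (for products). [folklore] -/
theorem cutPAd_iteratedFDeriv_le {a₂ : ℝ} (ha₂ : ∀ i, ‖((A i).symm : E' →L[ℝ] E')‖ ≤ a₂) (i : ι) (m : ℕ)
    {Mb : ℝ} (hMb : ∀ x, ‖iteratedFDeriv ℝ m (cutP0 Q) x‖ ≤ Mb) (z : E') :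
    ‖iteratedFDeriv ℝ m (cutPAd Q A i) z‖ ≤ a₂ ^ m * Mb := by
  have ha0 : 0 ≤ a₂ := (norm_nonneg _).trans (ha₂ i)
  rw [cutPAd_eq_fun]
  refine (norm_iteratedFDeriv_comp_affine_le _ _ (cutP0 Q).contDiff m z).trans ?_
  exact mul_le_mul (pow_le_pow_left₀ (norm_nonneg _) (ha₂ i) _) (hMb _) (norm_nonneg _) (pow_nonneg ha0 _)

/-- First frame derivatives as words of length one. [folklore] -/
theorem fderiv_apply_eq_iterDirDeriv (f : E' → F) (a : Fin (Module.finrank ℝ E')) (z : E') :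
    fderiv ℝ f z (stdOrthonormalBasis ℝ E' a) = iterDirDeriv ([a].map (stdOrthonormalBasis ℝ E')) f z := rfl

/-- Second frame derivatives as words of length two. [folklore] -/
theorem fderiv_fderiv_apply_eq_iterDirDeriv (f : E' → F) (a l : Fin (Module.finrank ℝ E')) (z : E') :
    fderiv ℝ (fun y ↦ fderiv ℝ f y (stdOrthonormalBasis ℝ E' l)) z (stdOrthonormalBasis ℝ E' a) =
      iterDirDeriv ([a, l].map (stdOrthonormalBasis ℝ E')) f z := rfl

/-- Words of the first frame derivative are words one longer. [folklore] -/
theorem iterDirDeriv_fderiv_apply_eq (f : E' → F) (lst : List (Fin (Module.finrank ℝ E'))) (a : Fin (Module.finrank ℝ E')) :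
    iterDirDeriv (lst.map (stdOrthonormalBasis ℝ E')) (fun z ↦ fderiv ℝ f z (stdOrthonormalBasis ℝ E' a)) =
      iterDirDeriv ((lst ++ [a]).map (stdOrthonormalBasis ℝ E')) f := by
  simp only [List.map_append, List.map_cons, List.map_nil, iterDirDeriv_append_singleton]

/-- Words of a second frame derivative are words two longer. [folklore] -/
theorem iterDirDeriv_fderiv_fderiv_apply_eq (f : E' → F) (lst : List (Fin (Module.finrank ℝ E')))
    (a l : Fin (Module.finrank ℝ E')) :
    iterDirDeriv (lst.map (stdOrthonormalBasis ℝ E')) (fun z ↦ fderiv ℝ (fun y ↦ fderiv ℝ f y (stdOrthonormalBasis ℝ E' l))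
      z (stdOrthonormalBasis ℝ E' a)) = iterDirDeriv ((lst ++ [a, l]).map (stdOrthonormalBasis ℝ E')) f := by
  rw [show (fun z ↦ fderiv ℝ (fun y ↦ fderiv ℝ f y (stdOrthonormalBasis ℝ E' l)) z (stdOrthonormalBasis ℝ E' a)) =
    iterDirDeriv ([a, l].map (stdOrthonormalBasis ℝ E')) f from rfl, List.map_append, iterDirDeriv_append]

/-- The Laplacian as a sum of words of length two (smooth `f`). [folklore] -/
theorem laplacian_eq_sum_iterDirDeriv {f : E' → F} (hf : ContDiff ℝ ∞ f) :
    Δ f = fun z ↦ ∑ l, iterDirDeriv ([l, l].map (stdOrthonormalBasis ℝ E')) f z := by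
  funext z
  rw [laplacian_eq_sum_fderiv_fderiv_normed (stdOrthonormalBasis ℝ E') (hf.of_le (by norm_cast)) z]
  rfl

/-- **All cut-off multiplier bounds of `sobolevEnergy_flatErr_le` for the pulled-back cut-off**,
from a bound `M_b` of the iterated derivatives of the model cut-off up to order `K + 2` and a bound
`a₂ ≥ 1` of the inverse frames: with `Mcut = (n + 1) a₂^{K+2} M_b`, for every `k ≤ K`, all frame
words of `cut̃_i, ∂cut̃_i, ∂∂cut̃_i, Δcut̃_i` of length `≤ k` and their sup norms are `≤ Mcut`.
[folklore] -/
theorem cutAd_bounds {K : ℕ} {a₂ Mb : ℝ} (ha₂ : ∀ i, ‖((A i).symm : E' →L[ℝ] E')‖ ≤ a₂) (ha₂1 : 1 ≤ a₂)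
    (hMb : ∀ m ≤ K + 2, ∀ x, ‖iteratedFDeriv ℝ m (cut0 Q) x‖ ≤ Mb) (i : ι) {k : ℕ} (hk : k ≤ K) :
    let Mcut : ℝ := ((Module.finrank ℝ E' : ℝ) + 1) * a₂ ^ (K + 2) * Mb
    (∀ lst : List (Fin (Module.finrank ℝ E')), lst ≠ [] → lst.length ≤ k →
        ∀ z, ‖iterDirDeriv (lst.map (stdOrthonormalBasis ℝ E')) (cutAd Q A i) z‖ ≤ Mcut) ∧
      (∀ a z, |fderiv ℝ (cutAd Q A i) z (stdOrthonormalBasis ℝ E' a)| ≤ Mcut) ∧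
      (∀ a, ∀ lst : List (Fin (Module.finrank ℝ E')), lst ≠ [] → lst.length ≤ k →
        ∀ z, ‖iterDirDeriv (lst.map (stdOrthonormalBasis ℝ E'))
          (fun z ↦ fderiv ℝ (cutAd Q A i) z (stdOrthonormalBasis ℝ E' a)) z‖ ≤ Mcut) ∧
      (∀ a l z, |fderiv ℝ (fun y ↦ fderiv ℝ (cutAd Q A i) y (stdOrthonormalBasis ℝ E' l)) z
        (stdOrthonormalBasis ℝ E' a)| ≤ Mcut) ∧
      (∀ a l, ∀ lst : List (Fin (Module.finrank ℝ E')), lst ≠ [] → lst.length ≤ k →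
        ∀ z, ‖iterDirDeriv (lst.map (stdOrthonormalBasis ℝ E')) (fun z ↦ fderiv ℝ
          (fun y ↦ fderiv ℝ (cutAd Q A i) y (stdOrthonormalBasis ℝ E' l)) z (stdOrthonormalBasis ℝ E' a)) z‖ ≤ Mcut) ∧
      (∀ z, |(Δ (cutAd Q A i)) z| ≤ Mcut) ∧
      (∀ lst : List (Fin (Module.finrank ℝ E')), lst ≠ [] → lst.length ≤ k →
        ∀ z, ‖iterDirDeriv (lst.map (stdOrthonormalBasis ℝ E')) (Δ (cutAd Q A i)) z‖ ≤ Mcut) := by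
  intro Mcut
  have hMb0 : 0 ≤ Mb := (norm_nonneg _).trans (hMb 0 (Nat.zero_le _) 0)
  have ha0 : 0 ≤ a₂ := zero_le_one.trans ha₂1
  have hn : (1 : ℝ) ≤ (Module.finrank ℝ E' : ℝ) + 1 := by
    have : (0 : ℝ) ≤ Module.finrank ℝ E' := Nat.cast_nonneg _
    linarith
  -- the basic bound for every word of length `≤ K + 2`
  have hword : ∀ lst : List (Fin (Module.finrank ℝ E')), lst.length ≤ K + 2 →
      ∀ z, ‖iterDirDeriv (lst.map (stdOrthonormalBasis ℝ E')) (cutAd Q A i) z‖ ≤ a₂ ^ (K + 2) * Mb := by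
    intro lst hl z
    refine (cutAd_word_le ha₂ i lst (hMb _ hl) z).trans ?_
    exact mul_le_mul_of_nonneg_right (pow_le_pow_right₀ ha₂1 hl) hMb0
  have hbase : a₂ ^ (K + 2) * Mb ≤ Mcut := by
    show a₂ ^ (K + 2) * Mb ≤ ((Module.finrank ℝ E' : ℝ) + 1) * a₂ ^ (K + 2) * Mb
    rw [mul_assoc]
    exact le_mul_of_one_le_left (mul_nonneg (pow_nonneg ha0 _) hMb0) hn
  have hsmooth : ContDiff ℝ ∞ (cutAd Q A i) := contDiff_cutAd i
  refine ⟨fun lst _ hl z ↦ (hword lst (by omega) z).trans hbase, fun a z ↦ ?_, fun a lst _ hl z ↦ ?_,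
    fun a l z ↦ ?_, fun a l lst _ hl z ↦ ?_, fun z ↦ ?_, fun lst _ hl z ↦ ?_⟩
  · rw [fderiv_apply_eq_iterDirDeriv, ← Real.norm_eq_abs]
    exact (hword [a] (by simp) z).trans hbase
  · rw [iterDirDeriv_fderiv_apply_eq]
    exact (hword (lst ++ [a]) (by simp; omega) z).trans hbase
  · rw [fderiv_fderiv_apply_eq_iterDirDeriv, ← Real.norm_eq_abs]
    exact (hword [a, l] (by simp) z).trans hbase
  · rw [iterDirDeriv_fderiv_fderiv_apply_eq]
    exact (hword (lst ++ [a, l]) (by simp; omega) z).trans hbase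
  · rw [laplacian_eq_sum_iterDirDeriv hsmooth, ← Real.norm_eq_abs]
    calc ‖∑ l, iterDirDeriv ([l, l].map (stdOrthonormalBasis ℝ E')) (cutAd Q A i) z‖
        ≤ ∑ l, ‖iterDirDeriv ([l, l].map (stdOrthonormalBasis ℝ E')) (cutAd Q A i) z‖ := norm_sum_le _ _
      _ ≤ ∑ _l : Fin (Module.finrank ℝ E'), a₂ ^ (K + 2) * Mb := Finset.sum_le_sum fun l _ ↦ hword [l, l] (by simp) z
      _ = (Module.finrank ℝ E' : ℝ) * (a₂ ^ (K + 2) * Mb) := by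
          rw [Finset.sum_const, Finset.card_univ, Fintype.card_fin, nsmul_eq_mul]
      _ ≤ Mcut := by
          show _ ≤ ((Module.finrank ℝ E' : ℝ) + 1) * a₂ ^ (K + 2) * Mb
          rw [mul_assoc]
          exact mul_le_mul_of_nonneg_right (by linarith) (mul_nonneg (pow_nonneg ha0 _) hMb0)
  · rw [laplacian_eq_sum_iterDirDeriv hsmooth, iterDirDeriv_finset_sum _ (fun l _ ↦ contDiff_iterDirDeriv hsmooth _)]
    calc ‖∑ l, iterDirDeriv (lst.map (stdOrthonormalBasis ℝ E')) (iterDirDeriv ([l, l].map (stdOrthonormalBasis ℝ E'))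
          (cutAd Q A i)) z‖
        ≤ ∑ l, ‖iterDirDeriv (lst.map (stdOrthonormalBasis ℝ E')) (iterDirDeriv ([l, l].map (stdOrthonormalBasis ℝ E'))
          (cutAd Q A i)) z‖ := norm_sum_le _ _
      _ ≤ ∑ _l : Fin (Module.finrank ℝ E'), a₂ ^ (K + 2) * Mb := by
          refine Finset.sum_le_sum fun l _ ↦ ?_
          rw [← iterDirDeriv_append, ← List.map_append]
          exact hword (lst ++ [l, l]) (by simp; omega) z
      _ = (Module.finrank ℝ E' : ℝ) * (a₂ ^ (K + 2) * Mb) := by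
          rw [Finset.sum_const, Finset.card_univ, Fintype.card_fin, nsmul_eq_mul]
      _ ≤ Mcut := by
          show _ ≤ ((Module.finrank ℝ E' : ℝ) + 1) * a₂ ^ (K + 2) * Mb
          rw [mul_assoc]
          exact mul_le_mul_of_nonneg_right (by linarith) (mul_nonneg (pow_nonneg ha0 _) hMb0)

/-! ### The coefficient fields in adapted coordinates -/

section Coeff

variable {T : ℝ} {S : ℝ → E' → (E' →L[ℝ] E')} {F' : Type*} [NormedAddCommGroup F'] [InnerProductSpace ℝ F']
  {𝔟 : ℝ → E' → ((E' →L[ℝ] F') →L[ℝ] F')} {𝔠 : ℝ → E' → (F' →L[ℝ] F')}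

omit [FiniteDimensional ℝ E'] in
/-- The norm of precomposition by `M` is at most `‖M‖`. [folklore] -/
theorem norm_precompCLM_le (M : E' →L[ℝ] E') : ‖(precompCLM (F := F') M)‖ ≤ ‖M‖ :=
  ContinuousLinearMap.opNorm_le_bound _ (norm_nonneg _) fun P ↦ by
    rw [precompCLM_apply, mul_comm]; exact ContinuousLinearMap.opNorm_comp_le P M

/-- The rank-one embedding along a unit frame vector has norm at most one. [folklore] -/
theorem norm_smulRightL_innerSL_le (l : Fin (Module.finrank ℝ E')) :
    ‖ContinuousLinearMap.smulRightL ℝ E' F' (innerSL ℝ (stdOrthonormalBasis ℝ E' l))‖ ≤ 1 :=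
  ContinuousLinearMap.opNorm_le_bound _ zero_le_one fun w ↦ by
    have h : (ContinuousLinearMap.smulRightL ℝ E' F') (innerSL ℝ (stdOrthonormalBasis ℝ E' l)) w =
        (innerSL ℝ (stdOrthonormalBasis ℝ E' l)).smulRight w := rfl
    rw [h, ContinuousLinearMap.norm_smulRight_apply, innerSL_apply_norm, (stdOrthonormalBasis ℝ E').orthonormal.1 l]

/-- **Iterated derivatives of the adapted symbol**: `‖Dᵐ S̃_i(s)‖ ≤ a₁² a₂ᵐ M_S`. [folklore] -/
theorem norm_iteratedFDeriv_Sad_le {a₁ a₂ : ℝ} (ha₁ : ∀ i, ‖(A i : E' →L[ℝ] E')‖ ≤ a₁)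
    (ha₂ : ∀ i, ‖((A i).symm : E' →L[ℝ] E')‖ ≤ a₂) (i : ι) {s : ℝ} (hSs : ContDiff ℝ ∞ (S s)) (m : ℕ) {MS : ℝ}
    (hMS : ∀ y, ‖iteratedFDeriv ℝ m (S s) y‖ ≤ MS) (z : E') :
    ‖iteratedFDeriv ℝ m (Sad Q A S i s) z‖ ≤ a₁ ^ 2 * a₂ ^ m * MS := by
  have ha10 : 0 ≤ a₁ := (norm_nonneg _).trans (ha₁ i)
  have ha20 : 0 ≤ a₂ := (norm_nonneg _).trans (ha₂ i)
  have hMS0 : 0 ≤ MS := (norm_nonneg _).trans (hMS 0)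
  -- `S̃ = A ∘ (S(s) ∘ Ψ) ∘ A†`
  have hcomp : ContDiff ℝ ∞ fun z ↦ S s (((A i).symm : E' →L[ℝ] E') z + Q.c i) :=
    hSs.comp ((((A i).symm : E' →L[ℝ] E').contDiff).add contDiff_const)
  have hpre : ContDiff ℝ ∞ fun z ↦ S s (((A i).symm : E' →L[ℝ] E') z + Q.c i) ∘L ContinuousLinearMap.adjoint (A i : E' →L[ℝ] E') :=
    hcomp.clm_comp contDiff_const
  have heq : Sad Q A S i s = fun z ↦ (A i : E' →L[ℝ] E') ∘L
      ((fun z ↦ S s (((A i).symm : E' →L[ℝ] E') z + Q.c i) ∘L ContinuousLinearMap.adjoint (A i : E' →L[ℝ] E')) z) := rfl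
  rw [heq]
  have h1 := norm_iteratedFDeriv_postcomp_le hpre (A i : E' →L[ℝ] E') m z
  have h2 := norm_iteratedFDeriv_precomp_le hcomp (ContinuousLinearMap.adjoint (A i : E' →L[ℝ] E')) m z
  have h3 := norm_iteratedFDeriv_comp_affine_le ((A i).symm : E' →L[ℝ] E') (Q.c i) hSs m z
  rw [LinearIsometryEquiv.norm_map] at h2
  have hB : ‖((A i).symm : E' →L[ℝ] E')‖ ^ m ≤ a₂ ^ m := pow_le_pow_left₀ (norm_nonneg _) (ha₂ i) m
  calc _ ≤ ‖(A i : E' →L[ℝ] E')‖ * (‖(A i : E' →L[ℝ] E')‖ * (‖((A i).symm : E' →L[ℝ] E')‖ ^ m *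
        ‖iteratedFDeriv ℝ m (S s) (((A i).symm : E' →L[ℝ] E') z + Q.c i)‖)) :=
        h1.trans (mul_le_mul_of_nonneg_left (h2.trans (mul_le_mul_of_nonneg_left h3 (norm_nonneg _))) (norm_nonneg _))
    _ ≤ a₁ * (a₁ * (a₂ ^ m * MS)) :=
        mul_le_mul (ha₁ i) (mul_le_mul (ha₁ i) (mul_le_mul hB (hMS _) (norm_nonneg _) (pow_nonneg ha20 _))
          (by positivity) ha10) (by positivity) ha10
    _ = a₁ ^ 2 * a₂ ^ m * MS := by ring

/-- **Iterated derivatives of the matrix entries of `S̃ - 1`**: `≤ a₁² a₂ᵐ M_S + 1`. [folklore] -/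
theorem norm_iteratedFDeriv_entry_le {a₁ a₂ : ℝ} (ha₁ : ∀ i, ‖(A i : E' →L[ℝ] E')‖ ≤ a₁)
    (ha₂ : ∀ i, ‖((A i).symm : E' →L[ℝ] E')‖ ≤ a₂) (i : ι) {s : ℝ} (hSs : ContDiff ℝ ∞ (S s)) (m : ℕ) {MS : ℝ}
    (hMS : ∀ y, ‖iteratedFDeriv ℝ m (S s) y‖ ≤ MS) (a l : Fin (Module.finrank ℝ E')) (z : E') :
    ‖iteratedFDeriv ℝ m (fun z ↦ ⟪stdOrthonormalBasis ℝ E' a, (Sad Q A S i s z - 1) (stdOrthonormalBasis ℝ E' l)⟫) z‖ ≤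
      a₁ ^ 2 * a₂ ^ m * MS + 1 := by
  have hSad : ContDiff ℝ ∞ (Sad Q A S i s) := by
    have hpsi : ContDiff ℝ ∞ (psi Q A i) := contDiff_psi i
    have h : ContDiff ℝ ∞ fun z ↦ S s (psi Q A i z) ∘L ContinuousLinearMap.adjoint (A i : E' →L[ℝ] E') :=
      (hSs.comp hpsi).clm_comp contDiff_const
    exact contDiff_const.clm_comp h
  have hsub : ContDiff ℝ ∞ fun z ↦ Sad Q A S i s z - 1 := hSad.sub contDiff_const
  refine (norm_iteratedFDeriv_inner_apply_le hsub _ _ m z).trans ?_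
  rw [(stdOrthonormalBasis ℝ E').orthonormal.1 a, (stdOrthonormalBasis ℝ E').orthonormal.1 l, one_mul, one_mul]
  refine (norm_iteratedFDeriv_sub_const_le hSad _ m z).trans ?_
  exact add_le_add (norm_iteratedFDeriv_Sad_le ha₁ ha₂ i hSs m hMS z) ContinuousLinearMap.norm_id_le

/-- **Iterated derivatives of the adapted first-order coefficient along a frame direction**:
`‖Dᵐ (B̃_i(s) ∘ smulRightL b_l)‖ ≤ a₁ a₂ᵐ M_𝔟`. [folklore] -/
theorem norm_iteratedFDeriv_Bad_le {a₁ a₂ : ℝ} (ha₁ : ∀ i, ‖(A i : E' →L[ℝ] E')‖ ≤ a₁)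
    (ha₂ : ∀ i, ‖((A i).symm : E' →L[ℝ] E')‖ ≤ a₂) (i : ι) {s : ℝ} (h𝔟s : ContDiff ℝ ∞ (𝔟 s)) (m : ℕ) {Mb : ℝ}
    (hM : ∀ y, ‖iteratedFDeriv ℝ m (𝔟 s) y‖ ≤ Mb) (l : Fin (Module.finrank ℝ E')) (z : E') :
    ‖iteratedFDeriv ℝ m (fun z ↦ (Bad Q A 𝔟 i s z).comp
      (ContinuousLinearMap.smulRightL ℝ E' F' (innerSL ℝ (stdOrthonormalBasis ℝ E' l)))) z‖ ≤ a₁ * a₂ ^ m * Mb := by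
  have ha10 : 0 ≤ a₁ := (norm_nonneg _).trans (ha₁ i)
  have hM0 : 0 ≤ Mb := (norm_nonneg _).trans (hM 0)
  have hcomp : ContDiff ℝ ∞ fun z ↦ 𝔟 s (((A i).symm : E' →L[ℝ] E') z + Q.c i) :=
    h𝔟s.comp ((((A i).symm : E' →L[ℝ] E').contDiff).add contDiff_const)
  have hBad : ContDiff ℝ ∞ (Bad Q A 𝔟 i s) := hcomp.clm_comp contDiff_const
  have ha20 : 0 ≤ a₂ := (norm_nonneg _).trans (ha₂ i)
  have h1 := norm_iteratedFDeriv_precomp_le hBad (ContinuousLinearMap.smulRightL ℝ E' F'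
    (innerSL ℝ (stdOrthonormalBasis ℝ E' l))) m z
  have h2 := norm_iteratedFDeriv_precomp_le hcomp (precompCLM (F := F') (A i : E' →L[ℝ] E')) m z
  have h3 := norm_iteratedFDeriv_comp_affine_le ((A i).symm : E' →L[ℝ] E') (Q.c i) h𝔟s m z
  have hB : ‖((A i).symm : E' →L[ℝ] E')‖ ^ m ≤ a₂ ^ m := pow_le_pow_left₀ (norm_nonneg _) (ha₂ i) m
  have hP : ‖precompCLM (F := F') (A i : E' →L[ℝ] E')‖ ≤ a₁ := (norm_precompCLM_le _).trans (ha₁ i)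
  calc _ ≤ 1 * (‖precompCLM (F := F') (A i : E' →L[ℝ] E')‖ * (‖((A i).symm : E' →L[ℝ] E')‖ ^ m *
        ‖iteratedFDeriv ℝ m (𝔟 s) (((A i).symm : E' →L[ℝ] E') z + Q.c i)‖)) :=
        h1.trans (mul_le_mul (norm_smulRightL_innerSL_le l) (h2.trans (mul_le_mul_of_nonneg_left h3 (norm_nonneg _)))
          (norm_nonneg _) zero_le_one)
    _ ≤ 1 * (a₁ * (a₂ ^ m * Mb)) :=
        mul_le_mul_of_nonneg_left (mul_le_mul hP (mul_le_mul hB (hM _) (norm_nonneg _) (pow_nonneg ha20 _))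
          (by positivity) ha10) zero_le_one
    _ = a₁ * a₂ ^ m * Mb := by ring

omit [FiniteDimensional ℝ E'] in
/-- **Iterated derivatives of the adapted zeroth-order coefficient**: `‖Dᵐ C̃_i(s)‖ ≤ a₂ᵐ M_𝔠`.
[folklore] -/
theorem norm_iteratedFDeriv_Cad_le {a₂ : ℝ} (ha₂ : ∀ i, ‖((A i).symm : E' →L[ℝ] E')‖ ≤ a₂) (i : ι) {s : ℝ}
    (h𝔠s : ContDiff ℝ ∞ (𝔠 s)) (m : ℕ) {Mc : ℝ} (hM : ∀ y, ‖iteratedFDeriv ℝ m (𝔠 s) y‖ ≤ Mc) (z : E') :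
    ‖iteratedFDeriv ℝ m (Cad Q A 𝔠 i s) z‖ ≤ a₂ ^ m * Mc := by
  have hM0 : 0 ≤ Mc := (norm_nonneg _).trans (hM 0)
  refine (norm_iteratedFDeriv_comp_affine_le ((A i).symm : E' →L[ℝ] E') (Q.c i) h𝔠s m z).trans ?_
  exact mul_le_mul (pow_le_pow_left₀ (norm_nonneg _) (ha₂ i) m) (hM _) (norm_nonneg _)
    (pow_nonneg ((norm_nonneg _).trans (ha₂ i)) _)

end Coeff


/-! ### The partition multipliers, the push-forward and the transition constants -/

section Rest

omit [FiniteDimensional ℝ E'] in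
/-- The partition functions in adapted coordinates are the profile composed with the inverse
frame. [folklore] -/
theorem rho_comp_psi_eq {ρ₀ : E' → ℝ} (hQρ : ∀ i x, Q.ρ i x = ρ₀ (x - Q.c i)) (j : ι) :
    (fun z ↦ Q.ρ j (psi Q A j z)) = fun z ↦ ρ₀ (((A j).symm : E' →L[ℝ] E') z + 0) := by
  funext z
  rw [hQρ, psi, add_sub_cancel_right, add_zero]
  rfl

/-- **Word bounds of the partition multipliers in adapted coordinates**, from the profile:
`‖∂_β (ρ_j ∘ Ψ_j)(z)‖ ≤ a₂^K M_ρ` for `|β| ≤ K`. [folklore] -/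
theorem flat_hρw {ρ₀ : E' → ℝ} (hρ₀ : ContDiff ℝ ∞ ρ₀) (hQρ : ∀ i x, Q.ρ i x = ρ₀ (x - Q.c i)) {K : ℕ}
    {a₂ Mρ : ℝ} (ha₂ : ∀ i, ‖((A i).symm : E' →L[ℝ] E')‖ ≤ a₂) (ha₂1 : 1 ≤ a₂)
    (hMρ : ∀ m ≤ K, ∀ x, ‖iteratedFDeriv ℝ m ρ₀ x‖ ≤ Mρ) (j : ι) (lst : List (Fin (Module.finrank ℝ E')))
    (hl : lst.length ≤ K) (z : E') :
    ‖iterDirDeriv (lst.map (stdOrthonormalBasis ℝ E')) (fun z ↦ Q.ρ j (psi Q A j z)) z‖ ≤ a₂ ^ K * Mρ := by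
  have hMρ0 : 0 ≤ Mρ := (norm_nonneg _).trans (hMρ 0 (Nat.zero_le _) 0)
  rw [rho_comp_psi_eq hQρ j]
  refine (norm_iterDirDeriv_frame_comp_affine_le _ _ hρ₀ lst z).trans ?_
  exact mul_le_mul ((pow_le_pow_left₀ (norm_nonneg _) (ha₂ j) _).trans (pow_le_pow_right₀ ha₂1 hl))
    (hMρ _ hl _) (norm_nonneg _) (pow_nonneg (zero_le_one.trans ha₂1) _)

omit [Fintype ι] in
/-- **The push-forward transport constants**: `(max 1 ‖A_i‖²)^k |det A_i|⁻¹ ≤ (max 1 a₁²)^K n! a₂ⁿ`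
for `k ≤ K`. [folklore] -/
theorem flat_hpush {K : ℕ} {a₁ a₂ : ℝ} (ha₁ : ∀ i, ‖(A i : E' →L[ℝ] E')‖ ≤ a₁)
    (ha₂ : ∀ i, ‖((A i).symm : E' →L[ℝ] E')‖ ≤ a₂) {k : ℕ} (hk : k ≤ K) (i : ι) :
    ENNReal.ofReal (max 1 (‖(A i : E' →L[ℝ] E')‖ ^ 2) ^ k *
        |(LinearMap.det ((A i : E' →L[ℝ] E') : E' →ₗ[ℝ] E'))⁻¹|) ≤
      ENNReal.ofReal (max 1 (a₁ ^ 2) ^ K * ((Module.finrank ℝ E').factorial * a₂ ^ Module.finrank ℝ E')) := by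
  have ha20 : 0 ≤ a₂ := (norm_nonneg _).trans (ha₂ i)
  refine ENNReal.ofReal_le_ofReal (mul_le_mul ?_ ?_ (abs_nonneg _) (pow_nonneg (by positivity) _))
  · calc max 1 (‖(A i : E' →L[ℝ] E')‖ ^ 2) ^ k ≤ max 1 (a₁ ^ 2) ^ k :=
          pow_le_pow_left₀ (by positivity) (max_le_max le_rfl (pow_le_pow_left₀ (norm_nonneg _) (ha₁ i) 2)) k
      _ ≤ max 1 (a₁ ^ 2) ^ K := pow_le_pow_right₀ (le_max_left _ _) hk
  · -- `|det A|⁻¹ = |det A⁻¹| ≤ n! ‖A⁻¹‖ⁿ`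
    have hdet : (LinearMap.det ((A i : E' →L[ℝ] E') : E' →ₗ[ℝ] E'))⁻¹ =
        LinearMap.det (((A i).symm : E' →L[ℝ] E') : E' →ₗ[ℝ] E') :=
      ((A i).det_coe_symm).symm
    rw [hdet]
    refine (abs_det_le_factorial_mul_norm_pow _).trans ?_
    exact mul_le_mul_of_nonneg_left (pow_le_pow_left₀ (norm_nonneg _) (ha₂ i) _) (Nat.cast_nonneg _)

/-- **The transition transport constants between neighbours**: if `‖A_i A_j⁻¹‖ ≤ 1 + κ` for all
neighbouring pairs then, for `k' ≤ k ≤ K`,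
`(max 1 ‖A_i A_j⁻¹‖²)^{k'} |det (A_i A_j⁻¹)|⁻¹ ≤ ((1+κ)²)^K n! (1+κ)ⁿ`. [folklore] -/
theorem flat_htr {K : ℕ} {κ : ℝ} (hκ0 : 0 ≤ κ)
    (hκ : ∀ j, ∀ i ∈ nbrs Q j, ‖(A i : E' →L[ℝ] E') ∘L ((A j).symm : E' →L[ℝ] E')‖ ≤ 1 + κ) {k : ℕ} (hk : k ≤ K)
    (j : ι) (i : ι) (hi : i ∈ nbrs Q j) (k' : ℕ) (hk' : k' ≤ k) :
    ENNReal.ofReal (max 1 (‖((A i : E' →L[ℝ] E') ∘L ((A j).symm : E' →L[ℝ] E'))‖ ^ 2) ^ k' *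
      |(LinearMap.det (((A i : E' →L[ℝ] E') ∘L ((A j).symm : E' →L[ℝ] E') : E' →L[ℝ] E') : E' →ₗ[ℝ] E'))⁻¹|) ≤
      ENNReal.ofReal (((1 + κ) ^ 2) ^ K * ((Module.finrank ℝ E').factorial * (1 + κ) ^ Module.finrank ℝ E')) := by
  have h1 : 1 ≤ 1 + κ := by linarith
  refine ENNReal.ofReal_le_ofReal (mul_le_mul ?_ ?_ (abs_nonneg _) (pow_nonneg (by positivity) _))
  · calc max 1 (‖((A i : E' →L[ℝ] E') ∘L ((A j).symm : E' →L[ℝ] E'))‖ ^ 2) ^ k' ≤ ((1 + κ) ^ 2) ^ k' := by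
          refine pow_le_pow_left₀ (by positivity) (max_le (one_le_pow₀ h1) ?_) k'
          exact pow_le_pow_left₀ (norm_nonneg _) (hκ j i hi) 2
      _ ≤ ((1 + κ) ^ 2) ^ K := pow_le_pow_right₀ (one_le_pow₀ h1) (hk'.trans hk)
  · -- the inverse transition is the transition with the roles exchanged
    set L : E' ≃L[ℝ] E' := (A j).symm.trans (A i) with hL
    have hLc : ((A i : E' →L[ℝ] E') ∘L ((A j).symm : E' →L[ℝ] E')) = (L : E' →L[ℝ] E') := by ext z; simp [hL]
    have hLs : (L.symm : E' →L[ℝ] E') = (A j : E' →L[ℝ] E') ∘L ((A i).symm : E' →L[ℝ] E') := by ext z; simp [hL]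
    have hdet : (LinearMap.det (((A i : E' →L[ℝ] E') ∘L ((A j).symm : E' →L[ℝ] E') : E' →L[ℝ] E') : E' →ₗ[ℝ] E'))⁻¹ =
        LinearMap.det (((A j : E' →L[ℝ] E') ∘L ((A i).symm : E' →L[ℝ] E') : E' →L[ℝ] E') : E' →ₗ[ℝ] E') := by
      rw [hLc, ← hLs]
      exact (L.det_coe_symm).symm
    rw [hdet]
    refine (abs_det_le_factorial_mul_norm_pow _).trans ?_
    refine mul_le_mul_of_nonneg_left (pow_le_pow_left₀ (norm_nonneg _) ?_ _) (Nat.cast_nonneg _)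
    exact hκ i j ((mem_nbrs_comm Q).1 hi)

end Rest



end FlatStep

namespace FlatStep

/-! ### The slice bounds, uniformly in the patch and in time -/

section Slice

variable {T : ℝ} {S : ℝ → E' → (E' →L[ℝ] E')} {F' : Type*} [NormedAddCommGroup F'] [InnerProductSpace ℝ F']
  {𝔟 : ℝ → E' → ((E' →L[ℝ] F') →L[ℝ] F')} {𝔠 : ℝ → E' → (F' →L[ℝ] F')}
  [MeasurableSpace E'] [BorelSpace E'] [FiniteDimensional ℝ F']

/-- **The slice bounds of the adapted residuals, uniformly in the patch, the time and the data.**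
From uniform bounds of the frames (`a₁, a₂ ≥ 1`), of the iterated derivatives up to order `K + 2`
of the model cut-offs (`M_b, M_bP ≥ 1`) and of the coefficient slices (`M_S, M_𝔟, M_𝔠`), and the
`η`-closeness of the adapted symbols to the identity on the outer cut-off supports: for every
`k ≤ K` there is a finite `B₀` (explicit in the proof; independent of the data and of the region of
the patch family) with, for all slab-smooth data `Θ`, all patches `i` and all `s ∈ [0, T]`,
`E_k(err̃_i(s)) ≤ 80 n² η² Σ E_k(∂∂w̃_i(s)) + B₀ (Σ E_k(∂w̃_i(s)) + E_k(w̃_i(s)))`.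
[cite: Hormander1985III, §17.1] -/
theorem flat_hslice (hT : 0 < T) (hS : IsSmoothSpaceTimeOn (Icc 0 T) S) (h𝔟 : IsSmoothSpaceTimeOn (Icc 0 T) 𝔟)
    (h𝔠 : IsSmoothSpaceTimeOn (Icc 0 T) 𝔠) {K : ℕ} {a₁ a₂ Mb MbP MS M𝔟 M𝔠 η : ℝ} (ha₁1 : 1 ≤ a₁) (ha₂1 : 1 ≤ a₂)
    (hMb1 : 1 ≤ Mb) (hMbP1 : 1 ≤ MbP)
    (hMS : ∀ s ∈ Icc 0 T, ∀ m ≤ K + 2, ∀ y, ‖iteratedFDeriv ℝ m (S s) y‖ ≤ MS)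
    (hM𝔟 : ∀ s ∈ Icc 0 T, ∀ m ≤ K + 2, ∀ y, ‖iteratedFDeriv ℝ m (𝔟 s) y‖ ≤ M𝔟)
    (hM𝔠 : ∀ s ∈ Icc 0 T, ∀ m ≤ K + 2, ∀ y, ‖iteratedFDeriv ℝ m (𝔠 s) y‖ ≤ M𝔠)
    (hη0 : 0 ≤ η) (hη1 : η ≤ 1) (k : ℕ) (hk : k ≤ K) :
    ∃ B₀ : ℝ≥0∞, B₀ ≠ ⊤ ∧ ∀ {ι : Type*} [Fintype ι] (Q : FlatPatches E' ι) (A : ι → E' ≃L[ℝ] E'),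
      (∀ i, ‖(A i : E' →L[ℝ] E')‖ ≤ a₁) → (∀ i, ‖((A i).symm : E' →L[ℝ] E')‖ ≤ a₂) →
      (∀ m ≤ K + 2, ∀ x, ‖iteratedFDeriv ℝ m (cut0 Q) x‖ ≤ Mb) →
      (∀ m ≤ K + 2, ∀ x, ‖iteratedFDeriv ℝ m (cutP0 Q) x‖ ≤ MbP) →
      (∀ i, ∀ s ∈ Icc 0 T, ∀ z ∈ tsupport (cutPAd Q A i), ‖Sad Q A S i s z - 1‖ ≤ η) →
      ∀ Θ : ℝ → E' → F', IsSmoothSpaceTimeOn (Icc 0 T) Θ → ∀ i, ∀ s ∈ Icc 0 T,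
      sobolevEnergy k (errAd Q A T S 𝔟 𝔠 Θ i s) ≤
        ENNReal.ofReal (80 * (Module.finrank ℝ E' : ℝ) ^ 2 * η ^ 2) * ∑ a, ∑ l,
            sobolevEnergy k (fun y ↦ fderiv ℝ (fun z ↦ fderiv ℝ (wAd Q A T Θ i s) z
              (stdOrthonormalBasis ℝ E' l)) y (stdOrthonormalBasis ℝ E' a)) +
          B₀ * (∑ l, sobolevEnergy k (fun z ↦ fderiv ℝ (wAd Q A T Θ i s) z (stdOrthonormalBasis ℝ E' l)) +
            sobolevEnergy k (wAd Q A T Θ i s)) := by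
  obtain ⟨C, hCtop, hC⟩ := sobolevEnergy_flatErr_le (E' := E') (F' := F') k
  -- the constants
  have hTne : (Icc (0 : ℝ) T).Nonempty := ⟨0, le_rfl, hT.le⟩
  have ha20 : 0 ≤ a₂ := zero_le_one.trans ha₂1
  have ha10 : 0 ≤ a₁ := zero_le_one.trans ha₁1
  have hMS0 : 0 ≤ MS := (norm_nonneg _).trans (hMS 0 ⟨le_rfl, hT.le⟩ 0 (Nat.zero_le _) 0)
  have hM𝔟0 : 0 ≤ M𝔟 := (norm_nonneg _).trans (hM𝔟 0 ⟨le_rfl, hT.le⟩ 0 (Nat.zero_le _) 0)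
  have hM𝔠0 : 0 ≤ M𝔠 := (norm_nonneg _).trans (hM𝔠 0 ⟨le_rfl, hT.le⟩ 0 (Nat.zero_le _) 0)
  obtain ⟨Mcut, hMcut⟩ : ∃ Mcut : ℝ, Mcut = ((Module.finrank ℝ E' : ℝ) + 1) * a₂ ^ (K + 2) * Mb := ⟨_, rfl⟩
  obtain ⟨Mφ, hMφ⟩ : ∃ Mφ : ℝ, Mφ = a₂ ^ (K + 2) * MbP := ⟨_, rfl⟩
  obtain ⟨Mtot, hMtot⟩ : ∃ Mtot : ℝ, Mtot = (a₁ ^ 2 * a₂ ^ (K + 2) * MS + 1) + a₁ * a₂ ^ (K + 2) * M𝔟 + a₂ ^ (K + 2) * M𝔠 :=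
    ⟨_, rfl⟩
  obtain ⟨Mc, hMc⟩ : ∃ Mc : ℝ, Mc = 2 ^ K * Mφ * Mtot := ⟨_, rfl⟩
  have hpowK : 1 ≤ a₂ ^ (K + 2) := one_le_pow₀ ha₂1
  have hMφ1 : 1 ≤ Mφ := by rw [hMφ]; exact one_le_mul_of_one_le_of_one_le hpowK hMbP1
  have hMtot1 : 1 ≤ Mtot := by
    rw [hMtot]
    have h1 : 0 ≤ a₁ ^ 2 * a₂ ^ (K + 2) * MS := by positivity
    have h2 : 0 ≤ a₁ * a₂ ^ (K + 2) * M𝔟 := by positivity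
    have h3 : 0 ≤ a₂ ^ (K + 2) * M𝔠 := by positivity
    linarith
  have hMc1 : 1 ≤ Mc := by
    rw [hMc]; exact one_le_mul_of_one_le_of_one_le (one_le_mul_of_one_le_of_one_le (one_le_pow₀ (by norm_num)) hMφ1) hMtot1
  have hMcut1 : 1 ≤ Mcut := by
    rw [hMcut]
    refine one_le_mul_of_one_le_of_one_le (one_le_mul_of_one_le_of_one_le ?_ hpowK) hMb1
    have : (0 : ℝ) ≤ Module.finrank ℝ E' := Nat.cast_nonneg _
    linarith
  refine ⟨C * ENNReal.ofReal ((Mc ^ 2 + 1) * Mcut ^ 2), ENNReal.mul_ne_top hCtop ENNReal.ofReal_ne_top, ?_⟩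
  intro ι _ Q A ha₁ ha₂ hMb hMbP hη Θ hΘ i s hs
  -- the slice data
  have hSs : ContDiff ℝ ∞ (S s) := hS.contDiff_slice hs
  have h𝔟s : ContDiff ℝ ∞ (𝔟 s) := h𝔟.contDiff_slice hs
  have h𝔠s : ContDiff ℝ ∞ (𝔠 s) := h𝔠.contDiff_slice hs
  have hu : ContDiff ℝ ∞ (wAd Q A T Θ i s) := (isSmoothSpaceTimeOn_wAd Q A T Θ hT hΘ i).contDiff_slice hs
  obtain ⟨hw0, hd1, hw1, hd2, hw2, hdL, hwL⟩ := cutAd_bounds (Q := Q) (A := A) ha₂ ha₂1 hMb i hk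
  -- the outer cut-off
  have hφ : ContDiff ℝ ∞ (cutPAd Q A i) := contDiff_cutPAd i
  have hφj : ∀ j ≤ k, ∀ z, ‖iteratedFDeriv ℝ j (cutPAd Q A i) z‖ ≤ Mφ := by
    intro j hj z
    refine (cutPAd_iteratedFDeriv_le ha₂ i j (hMbP j (by omega)) z).trans ?_
    rw [hMφ]
    exact mul_le_mul_of_nonneg_right (pow_le_pow_right₀ ha₂1 (by omega)) (zero_le_one.trans hMbP1)
  have hφ1 : ∀ z, |cutPAd Q A i z| ≤ 1 := fun z ↦ by
    rw [cutPAd, abs_of_nonneg (Q.cutPlus i).nonneg]; exact (Q.cutPlus i).le_one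
  -- the three cut-off coefficient families: smoothness and word bounds
  have hSad : ContDiff ℝ ∞ (Sad Q A S i s) :=
    contDiff_const.clm_comp (((hSs.comp (contDiff_psi i)).clm_comp contDiff_const))
  have hGA : ∀ a l, ContDiff ℝ ∞ fun z ↦ ⟪stdOrthonormalBasis ℝ E' a, (Sad Q A S i s z - 1) (stdOrthonormalBasis ℝ E' l)⟫ :=
    fun a l ↦ contDiff_const.inner ℝ ((hSad.sub contDiff_const).clm_apply contDiff_const)
  have hGB : ∀ l, ContDiff ℝ ∞ fun z ↦ (Bad Q A 𝔟 i s z).comp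
      (ContinuousLinearMap.smulRightL ℝ E' F' (innerSL ℝ (stdOrthonormalBasis ℝ E' l))) := fun l ↦
    (((h𝔟s.comp (contDiff_psi i)).clm_comp contDiff_const)).clm_comp contDiff_const
  have hGC : ContDiff ℝ ∞ (Cad Q A 𝔠 i s) := h𝔠s.comp (contDiff_psi i)
  have hGAj : ∀ a l, ∀ j ≤ k, ∀ z, ‖iteratedFDeriv ℝ j (fun z ↦ ⟪stdOrthonormalBasis ℝ E' a,
      (Sad Q A S i s z - 1) (stdOrthonormalBasis ℝ E' l)⟫) z‖ ≤ Mtot := by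
    intro a l j hj z
    refine (norm_iteratedFDeriv_entry_le ha₁ ha₂ i hSs j (hMS s hs j (by omega)) a l z).trans ?_
    rw [hMtot]
    have h1 : a₁ ^ 2 * a₂ ^ j * MS ≤ a₁ ^ 2 * a₂ ^ (K + 2) * MS :=
      mul_le_mul_of_nonneg_right (mul_le_mul_of_nonneg_left (pow_le_pow_right₀ ha₂1 (by omega)) (by positivity)) hMS0
    have h2 : 0 ≤ a₁ * a₂ ^ (K + 2) * M𝔟 := by positivity
    have h3 : 0 ≤ a₂ ^ (K + 2) * M𝔠 := by positivity
    linarith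
  have hGBj : ∀ l, ∀ j ≤ k, ∀ z, ‖iteratedFDeriv ℝ j (fun z ↦ (Bad Q A 𝔟 i s z).comp
      (ContinuousLinearMap.smulRightL ℝ E' F' (innerSL ℝ (stdOrthonormalBasis ℝ E' l)))) z‖ ≤ Mtot := by
    intro l j hj z
    refine (norm_iteratedFDeriv_Bad_le ha₁ ha₂ i h𝔟s j (hM𝔟 s hs j (by omega)) l z).trans ?_
    rw [hMtot]
    have h1 : a₁ * a₂ ^ j * M𝔟 ≤ a₁ * a₂ ^ (K + 2) * M𝔟 :=
      mul_le_mul_of_nonneg_right (mul_le_mul_of_nonneg_left (pow_le_pow_right₀ ha₂1 (by omega)) ha10) hM𝔟0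
    have h2 : 0 ≤ a₁ ^ 2 * a₂ ^ (K + 2) * MS + 1 := by positivity
    have h3 : 0 ≤ a₂ ^ (K + 2) * M𝔠 := by positivity
    linarith
  have hGCj : ∀ j ≤ k, ∀ z, ‖iteratedFDeriv ℝ j (Cad Q A 𝔠 i s) z‖ ≤ Mtot := by
    intro j hj z
    refine (norm_iteratedFDeriv_Cad_le ha₂ i h𝔠s j (hM𝔠 s hs j (by omega)) z).trans ?_
    rw [hMtot]
    have h1 : a₂ ^ j * M𝔠 ≤ a₂ ^ (K + 2) * M𝔠 := mul_le_mul_of_nonneg_right (pow_le_pow_right₀ ha₂1 (by omega)) hM𝔠0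
    have h2 : 0 ≤ a₁ ^ 2 * a₂ ^ (K + 2) * MS + 1 := by positivity
    have h3 : 0 ≤ a₁ * a₂ ^ (K + 2) * M𝔟 := by positivity
    linarith
  -- words of products with the outer cut-off: `≤ 2^{|β|} Mφ Mtot ≤ Mc`
  have hprod : ∀ {G : E' → ℝ}, ContDiff ℝ ∞ G → (∀ j ≤ k, ∀ z, ‖iteratedFDeriv ℝ j G z‖ ≤ Mtot) →
      ∀ lst : List (Fin (Module.finrank ℝ E')), lst.length ≤ k →
        ∀ z, ‖iterDirDeriv (lst.map (stdOrthonormalBasis ℝ E')) (fun y ↦ cutPAd Q A i y * G y) z‖ ≤ Mc := by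
    intro G hG hGj lst hl z
    have h := norm_iterDirDeriv_frame_smul_le (F := ℝ) hφ hG lst z (zero_le_one.trans hMφ1)
      (fun j hj ↦ hφj j (hj.trans hl) z) (fun j hj ↦ hGj j (hj.trans hl) z)
    simp only [smul_eq_mul] at h
    refine h.trans ?_
    rw [hMc]
    exact mul_le_mul_of_nonneg_right (mul_le_mul_of_nonneg_right (pow_le_pow_right₀ (by norm_num) (hl.trans hk))
      (zero_le_one.trans hMφ1)) (zero_le_one.trans hMtot1)
  have hprodV : ∀ {V : Type _} [NormedAddCommGroup V] [NormedSpace ℝ V] {G : E' → V}, ContDiff ℝ ∞ G →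
      (∀ j ≤ k, ∀ z, ‖iteratedFDeriv ℝ j G z‖ ≤ Mtot) →
      ∀ lst : List (Fin (Module.finrank ℝ E')), lst.length ≤ k →
        ∀ z, ‖iterDirDeriv (lst.map (stdOrthonormalBasis ℝ E')) (fun y ↦ cutPAd Q A i y • G y) z‖ ≤ Mc := by
    intro V _ _ G hG hGj lst hl z
    have h := norm_iterDirDeriv_frame_smul_le hφ hG lst z (zero_le_one.trans hMφ1)
      (fun j hj ↦ hφj j (hj.trans hl) z) (fun j hj ↦ hGj j (hj.trans hl) z)
    refine h.trans ?_
    rw [hMc]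
    exact mul_le_mul_of_nonneg_right (mul_le_mul_of_nonneg_right (pow_le_pow_right₀ (by norm_num) (hl.trans hk))
      (zero_le_one.trans hMφ1)) (zero_le_one.trans hMtot1)
  -- apply the energy lemma
  have hres := hC (Ss := Sad Q A S i s) (𝔟s := Bad Q A 𝔟 i s) (𝔠s := Cad Q A 𝔠 i s) (cut := cutAd Q A i)
    (cutP := cutPAd Q A i) (u := wAd Q A T Θ i s) (η := η) (Mc := Mc) (Mcut := Mcut)
    (contDiff_cutAd i) hu (fun z hz ↦ cutPAd_eq_one i hz) (abs_cutAd_le_one i) hMcut1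
    (by simpa only [hMcut] using hw0) (by simpa only [hMcut] using hd1) (by simpa only [hMcut] using hw1)
    (by simpa only [hMcut] using hd2) (by simpa only [hMcut] using hw2) (by simpa only [hMcut] using hdL)
    (by simpa only [hMcut] using hwL)
    (fun a l ↦ hφ.mul (hGA a l)) hη0 hη1
    (fun a l z ↦ by
      by_cases hz : z ∈ tsupport (cutPAd Q A i)
      · rw [abs_mul]
        refine (mul_le_mul (hφ1 z) ((abs_real_inner_le_norm _ _).trans ?_) (abs_nonneg _) zero_le_one).trans_eq (one_mul η)
        rw [(stdOrthonormalBasis ℝ E').orthonormal.1 a, one_mul]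
        refine (ContinuousLinearMap.le_opNorm _ _).trans ?_
        rw [(stdOrthonormalBasis ℝ E').orthonormal.1 l, mul_one]
        exact hη i s hs z hz
      · rw [image_eq_zero_of_notMem_tsupport hz, zero_mul, abs_zero]; exact hη0)
    (zero_le_one.trans hMc1)
    (fun a l z ↦ by
      have h := hprod (hGA a l) (hGAj a l) [] (Nat.zero_le _) z
      simpa [iterDirDeriv_nil] using h)
    (fun a l lst _ hl z ↦ hprod (hGA a l) (hGAj a l) lst hl z)
    (fun l ↦ hφ.smul (hGB l))
    (fun l z ↦ by
      have h := hprodV (hGB l) (hGBj l) [] (Nat.zero_le _) z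
      simpa [iterDirDeriv_nil] using h)
    (fun l lst _ hl z ↦ hprodV (hGB l) (hGBj l) lst hl z)
    (hφ.smul hGC)
    (fun z ↦ by
      have h := hprodV hGC hGCj [] (Nat.zero_le _) z
      simpa [iterDirDeriv_nil] using h)
    (fun lst _ hl z ↦ hprodV hGC hGCj lst hl z)
  exact hres

end Slice

end FlatStep


end Literature.Analysis.PDE

end
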